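import Literature.Geometry.Kaehler.ChernWeilTransgressionPolynomial
import HarnessLib

/-!
# Chern–Weil II: the de Rham class of the Chern character form is independent of the connection

Layer `Literature/Geometry/Kaehler`. This file DISCHARGES the named fact
`SmoothComplexVectorBundle.mk_eq_mk_of_isChernCharacterForm` of `ChernCharacter.lean`
("Chern–Weil II", Kobayashi, *Differential Geometry of Complex Vector Bundles* (1987), Ch. II §2,
(2.5)–(2.10)): for two connections `D₀`, `D₁` on a cocycle-presented `C^∞` complex vector bundle and
global smooth closed Chern character forms `θ₀`, `θ₁` of them, `[θ₀] = [θ₁]` in `H^{2k}_dR(M; ℂ)`.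

We follow Kobayashi's proof (p. 34): along the line of connections `D_t`, `ω_t = ω₀ + tα`,
`α = ω₁ − ω₀` (`ChernWeilTransgression`), the transgression form `φ = k ∫₀¹ f(α, Ω_t, …, Ω_t) dt`
(2.9) satisfies (2.10) `dφ = f(Ω₁) − f(Ω₀)`. The `t`-integral is computed in closed form: with the
letters `X₀ = Ω₀`, `X₁ = Dα`, `X₂ = α ∧ α` one has `Ω_t = X₀ + tX₁ + t²X₂`
(`ChernWeilTransgressionPolynomial`), `tr(Ω_tᵖ ∧ α) = Σ_e t^{wt e} τ_e` with
`τ_e = tr(word X p e ∧ α)`, and `∫₀¹ t^{wt e} dt = 1/(wt e + 1)`, so that on `U_i`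

  `ψ_i = Σ_e ((p+1)/(wt e + 1)) τ_e`      (`Connection.transgressionLocal`)

is `(p+1) ∫₀¹ tr(Ω_tᵖ ∧ α) dt`. The identity `dψ_i = tr(Ω₁^{p+1}) − tr(Ω₀^{p+1})` on `U_i`
(`Connection.mextDeriv_transgressionLocal_apply`) is (2.10): both `t ↦ tr(Ω_t^{p+1})(x)` and the
primitive `t ↦ Σ_e ((p+1)/(wt e+1)) t^{wt e+1} (dτ_e)(x)` are polynomial in `t` with the same
derivative — this is `(d/dt) tr(Ω_t^{p+1}) = (p+1) tr(D_tα ∧ Ω_tᵖ) = (p+1) d tr(Ω_tᵖ ∧ α)`, (2.8) and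
the key identity of `ChernWeilTransgression`, compared coefficientwise through the counting
identity of `MatrixFormWords` — hence differ by a constant (`is_const_of_deriv_eq_zero`), and the
primitive vanishes at `t = 0`. The `ψ_i` agree on overlaps (the letters, the words and `α` transform
by `g_ij⁻¹ (·) g_ij`, (I.1.7) and (I.1.17)), so they glue to a global smooth `(2p+1)`-form `φ` with
`dφ = tr(Ω₁^{p+1}) − tr(Ω₀^{p+1})` in every frame (`Connection.exists_transgression`); therefore
`θ₀ − θ₁ = d(−c_{p+1} φ)` is exact, which is the fact (`mk_eq_mk_of_isChernCharacterForm_holds`;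
the case `k = 0` is `θ₀ = r = θ₁`).

## References

* S. Kobayashi, *Differential Geometry of Complex Vector Bundles* (1987), Ch. I §1 (1.7), (1.17);
  Ch. II §2 (2.5)–(2.10).
-/

noncomputable section

open scoped Manifold ContDiff Topology Matrix
open Set Filter

universe u v

namespace Literature.Geometry.Kaehler

/-! ### Gauge relations at a point -/

namespace MatrixForm

variable {E : Type*} [NormedAddCommGroup E] [NormedSpace ℝ E]
  {H : Type*} [TopologicalSpace H] {I : ModelWithCorners ℝ E H}
  {M : Type*} [TopologicalSpace M] [ChartedSpace H M] {r k l : ℕ}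

/-- Gauge relations `A'(x) = (G A K)(x)` at a point add. [cite: Kobayashi1987, Ch. I §1 (1.17)] -/
theorem gauge_apply_add {A B A' B' : MatrixForm I M r k} {G K : M → Matrix (Fin r) (Fin r) ℂ} {x : M}
    (hA : ∀ a b, A' a b x = (mulLeft G (A.mulRight K)) a b x)
    (hB : ∀ a b, B' a b x = (mulLeft G (B.mulRight K)) a b x) (a b : Fin r) :
    (A' + B') a b x = (mulLeft G ((A + B).mulRight K)) a b x := by
  rw [mulRight_add, mulLeft_add, Matrix.add_apply, Pi.add_apply, Matrix.add_apply, Pi.add_apply,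
    hA, hB]

/-- Gauge relations at a point subtract. [cite: Kobayashi1987, Ch. I §1 (1.17)] -/
theorem gauge_apply_sub {A B A' B' : MatrixForm I M r k} {G K : M → Matrix (Fin r) (Fin r) ℂ} {x : M}
    (hA : ∀ a b, A' a b x = (mulLeft G (A.mulRight K)) a b x)
    (hB : ∀ a b, B' a b x = (mulLeft G (B.mulRight K)) a b x) (a b : Fin r) :
    (A' - B') a b x = (mulLeft G ((A - B).mulRight K)) a b x := by
  rw [sub_mulRight, mulLeft_sub, Matrix.sub_apply, Pi.sub_apply, Matrix.sub_apply, Pi.sub_apply,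
    hA, hB]

/-- Gauge relations at a point are homogeneous for real scalars. [cite: Kobayashi1987, Ch. I §1 (1.17)] -/
theorem gauge_apply_smul (c : ℝ) {A A' : MatrixForm I M r k} {G K : M → Matrix (Fin r) (Fin r) ℂ}
    {x : M} (hA : ∀ a b, A' a b x = (mulLeft G (A.mulRight K)) a b x) (a b : Fin r) :
    (c • A') a b x = (mulLeft G ((c • A).mulRight K)) a b x := by
  rw [smul_mulRight, mulLeft_smul, Matrix.smul_apply, Pi.smul_apply, Matrix.smul_apply,
    Pi.smul_apply, hA]

/-- A gauge relation at `x` only involves the values at `x`. [folklore] -/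
theorem gauge_apply_congr {A A₁ A' A₁' : MatrixForm I M r k} {G K : M → Matrix (Fin r) (Fin r) ℂ}
    {x : M} (h' : ∀ a b, A' a b x = A₁' a b x) (h : ∀ a b, A a b x = A₁ a b x)
    (hA : ∀ a b, A₁' a b x = (mulLeft G (A₁.mulRight K)) a b x) (a b : Fin r) :
    A' a b x = (mulLeft G (A.mulRight K)) a b x := by
  rw [h' a b, hA a b]
  exact mulLeft_apply_congr_right G fun c ↦ mulRight_apply_congr_left K fun d ↦ (h c d).symm

/-- **Gauge relations at a point multiply** (the computation behind (I.1.17) for powers):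
if `A'(x) = (G A K)(x)` and `B'(x) = (G B K)(x)` entrywise and `K G = 1` at `x`, then
`(A' ∧ B')(x) = (G (A ∧ B) K)(x)`. [cite: Kobayashi1987, Ch. I §1 (1.17)] -/
theorem wedge_apply_eq_gauge {A A' : MatrixForm I M r k} {B B' : MatrixForm I M r l}
    {G K : M → Matrix (Fin r) (Fin r) ℂ} {x : M} (hKG : (K * G) x = 1)
    (hA : ∀ a b, A' a b x = (mulLeft G (A.mulRight K)) a b x)
    (hB : ∀ a b, B' a b x = (mulLeft G (B.mulRight K)) a b x) (a b : Fin r) :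
    (A'.wedge B') a b x = (mulLeft G ((A.wedge B).mulRight K)) a b x := by
  rw [wedge_apply_congr (A' := (mulLeft G A).mulRight K) (B' := mulLeft G (B.mulRight K))
      (fun c ↦ by rw [hA a c, mulLeft_mulRight]) (fun c ↦ hB c b),
    mulRight_wedge, mulLeft_mulLeft,
    wedge_apply_congr (A' := mulLeft G A) (B' := B.mulRight K) (fun _ ↦ rfl)
      (fun c ↦ mulLeft_apply_of_eq_one hKG _ c b),
    ← mulLeft_wedge, ← wedge_mulRight]

/-- **Gauge-related matrices of forms have the same trace at the point**:
`tr(G C K)(x) = tr(C K G)(x) = tr C(x)` when `K G = 1` at `x`. [cite: Kobayashi1987, Ch. II §1 (2.1)] -/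
theorem trace_apply_eq_of_gauge {C C' : MatrixForm I M r k} {G K : M → Matrix (Fin r) (Fin r) ℂ}
    {x : M} (hKG : (K * G) x = 1) (h : ∀ a b, C' a b x = (mulLeft G (C.mulRight K)) a b x) :
    C'.trace x = C.trace x := by
  have h1 : C'.trace x = (mulLeft G (C.mulRight K)).trace x := by
    simp only [Matrix.trace, Matrix.diag_apply, Finset.sum_apply]
    exact Finset.sum_congr rfl fun a _ ↦ h a a
  rw [h1, trace_mulLeft, mulRight_mulRight]
  simp only [Matrix.trace, Matrix.diag_apply, Finset.sum_apply]
  exact Finset.sum_congr rfl fun a _ ↦ mulRight_apply_of_eq_one hKG _ a a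

/-! ### Two combinatorial identities on words -/

/-- The weight of a word splits off its first letter. [folklore] -/
theorem wordWt_cons {m : ℕ} (c : Fin 3) (e : Fin m → Fin 3) :
    wordWt (Fin.cons c e : Fin (m + 1) → Fin 3) = (c : ℕ) + wordWt e := by
  simp only [wordWt, Fin.sum_univ_succ, Fin.cons_zero, Fin.cons_succ]

/-- Summing over words of length `m + 1` = summing over the first letter and the tail. [folklore] -/
theorem sum_eq_sum_sum_cons {N : Type*} [AddCommMonoid N] {m : ℕ} (f : (Fin (m + 1) → Fin 3) → N) :
    ∑ e, f e = ∑ c : Fin 3, ∑ e' : Fin m → Fin 3, f (Fin.cons c e') := by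
  rw [← Fintype.sum_prod_type']
  exact (Fintype.sum_equiv (Fin.consEquiv fun _ ↦ Fin 3) (fun q ↦ f (Fin.cons q.1 q.2)) f
    fun _ ↦ rfl).symm

/-- `n t^{n+w-1} = n t^{n-1} t^w` (both sides vanish for `n = 0`). [folklore] -/
theorem cast_mul_pow_add_sub_one (n w : ℕ) (t : ℝ) :
    (n : ℝ) * t ^ (n + w - 1) = (n : ℝ) * t ^ (n - 1) * t ^ w := by
  cases n with
  | zero => simp
  | succ n => rw [show n + 1 + w - 1 = n + w by omega, Nat.add_sub_cancel, pow_add, mul_assoc]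

/-- **The counting identity behind `(d/dt) f(Ω_t, …, Ω_t) = k f(dΩ_t/dt, Ω_t, …, Ω_t)`**, written
on words: for a rotation-invariant `T` (as `e ↦ tr(word X (m+1) e)(x)` is),
`Σ_e wt(e) t^{wt e − 1} T(e) = (m+1) Σ_c Σ_{e'} c t^{c−1} t^{wt e'} T(cons c e')` — differentiate
`t^{wt e} = Π_j t^{e_j}` by the product rule and move each differentiated letter to the front.
[cite: Kobayashi1987, Ch. II §2 (2.10)] -/
theorem sum_wordWt_mul_pow_smul_eq {N : Type*} [AddCommGroup N] [Module ℝ N] {m : ℕ}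
    (T : (Fin (m + 1) → Fin 3) → N) (hT : ∀ e, T (e ∘ finRotate (m + 1)) = T e) (t : ℝ) :
    ∑ e, ((wordWt e : ℝ) * t ^ (wordWt e - 1)) • T e =
      ((m + 1 : ℕ) : ℝ) • ∑ c : Fin 3, ∑ e' : Fin m → Fin 3,
        (((c : ℕ) : ℝ) * t ^ ((c : ℕ) - 1) * t ^ wordWt e') • T (Fin.cons c e') := by
  have hf : ∀ e : Fin (m + 1) → Fin 3,
      (t ^ (wordWt (e ∘ finRotate (m + 1)) - 1)) • T (e ∘ finRotate (m + 1)) =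
        (t ^ (wordWt e - 1)) • T e := fun e ↦ by
    rw [wordWt_comp_finRotate, hT]
  have h1 : ∑ e, ((wordWt e : ℝ) * t ^ (wordWt e - 1)) • T e =
      ∑ e : Fin (m + 1) → Fin 3, (wordWt e : ℝ) • ((t ^ (wordWt e - 1)) • T e) :=
    Finset.sum_congr rfl fun e _ ↦ mul_smul _ _ _
  rw [h1, sum_wordWt_smul_eq (fun e ↦ (t ^ (wordWt e - 1)) • T e) hf,
    sum_apply_smul_eq_sum_apply_zero_smul (fun e ↦ (t ^ (wordWt e - 1)) • T e) hf (Fin.last m),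
    sum_eq_sum_sum_cons]
  congr 1
  refine Finset.sum_congr rfl fun c _ ↦ Finset.sum_congr rfl fun e' _ ↦ ?_
  rw [Fin.cons_zero, wordWt_cons, smul_smul, cast_mul_pow_add_sub_one]

end MatrixForm

namespace SmoothComplexVectorBundle

namespace Connection

variable {ι : Type*} {E : Type*} [NormedAddCommGroup E] [NormedSpace ℂ E]
  {M : Type*} [TopologicalSpace M] [ChartedSpace E M] {r : ℕ}
  {V : SmoothComplexVectorBundle ι E M r}

/-! ### The local transgression forms -/

/-- **The coefficients of the transgression integrand**: `τ_e = tr(word X p e ∧ α)` in the frame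
`s_i`, so that `tr(Ω_tᵖ ∧ α) = Σ_e t^{wt e} τ_e` on `U_i` (`f(α, Ω_t, …, Ω_t)` of Kobayashi (2.9),
expanded in powers of `t`). [cite: Kobayashi1987, Ch. II §2 (2.9)] -/
def transgressionTerm (D₀ D₁ : V.Connection) (i : ι) (p : ℕ) (e : Fin p → Fin 3) :
    MForm 𝓘(ℝ, E) M ℂ (2 * p + 1) :=
  ((MatrixForm.word (letters D₀ D₁ i) p e).wedge (D₁.form i - D₀.form i)).trace

/-- **The transgression form in the frame `s_i`**: `ψ_i = Σ_e ((p+1)/(wt e + 1)) τ_e`, i.e.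
`(p+1) ∫₀¹ tr(Ω_tᵖ ∧ α) dt` with the `t`-integral of the polynomial `Σ_e t^{wt e} τ_e` evaluated
(`∫₀¹ t^{wt e} dt = 1/(wt e + 1)`); this is Kobayashi's `φ = k ∫₀¹ f(α, Ω_t, …, Ω_t) dt` (2.9) for
`f = tr(Xᵏ)`, `k = p + 1`, up to the normalising constant of `ch_k`. [cite: Kobayashi1987, Ch. II §2 (2.9)] -/
def transgressionLocal (D₀ D₁ : V.Connection) (i : ι) (p : ℕ) : MForm 𝓘(ℝ, E) M ℂ (2 * p + 1) :=
  ∑ e : Fin p → Fin 3,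
    (((p + 1 : ℕ) : ℝ) / ((MatrixForm.wordWt e + 1 : ℕ) : ℝ)) • transgressionTerm D₀ D₁ i p e

/-! ### The letters as combinations of curvatures; gauge covariance -/

/-- **`X₁ = ½(Ω₁ − Ω₋₁)` at the points of `U_i`** (`Ω_{±1} = X₀ ± X₁ + X₂`, (2.7)).
[cite: Kobayashi1987, Ch. II §2 (2.7)] -/
theorem letters_one_apply (D₀ D₁ : V.Connection) {i : ι} {x : M} (hi : x ∈ V.baseSet i)
    (a b : Fin r) :
    letters D₀ D₁ i 1 a b x =
      ((2 : ℝ)⁻¹ • ((line D₀ D₁ 1).curvature i - (line D₀ D₁ (-1)).curvature i)) a b x := by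
  have h1 := curvature_line_apply D₀ D₁ hi 1 a b
  have h2 := curvature_line_apply D₀ D₁ hi (-1) a b
  rw [sum_pow_smul_letters] at h1 h2
  simp only [Matrix.add_apply, Pi.add_apply, Matrix.smul_apply, Pi.smul_apply, one_smul, one_pow,
    neg_one_sq] at h1 h2
  rw [Matrix.smul_apply, Pi.smul_apply, Matrix.sub_apply, Pi.sub_apply, h1, h2]
  have e : D₀.curvature i a b x + letters D₀ D₁ i 1 a b x + letters D₀ D₁ i 2 a b x -
      (D₀.curvature i a b x + (-1 : ℝ) • letters D₀ D₁ i 1 a b x + letters D₀ D₁ i 2 a b x) =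
        (2 : ℝ) • letters D₀ D₁ i 1 a b x := by
    rw [two_smul, neg_one_smul]
    abel
  rw [e, smul_smul, inv_mul_cancel₀ two_ne_zero, one_smul]

/-- **`X₂ = ½(Ω₁ + Ω₋₁) − Ω₀` at the points of `U_i`** (`Ω_{±1} = X₀ ± X₁ + X₂`, `X₀ = Ω₀`).
[cite: Kobayashi1987, Ch. II §2 (2.7)] -/
theorem letters_two_apply (D₀ D₁ : V.Connection) {i : ι} {x : M} (hi : x ∈ V.baseSet i)
    (a b : Fin r) :
    letters D₀ D₁ i 2 a b x =
      ((2 : ℝ)⁻¹ • ((line D₀ D₁ 1).curvature i + (line D₀ D₁ (-1)).curvature i) - D₀.curvature i)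
        a b x := by
  have h1 := curvature_line_apply D₀ D₁ hi 1 a b
  have h2 := curvature_line_apply D₀ D₁ hi (-1) a b
  rw [sum_pow_smul_letters] at h1 h2
  simp only [Matrix.add_apply, Pi.add_apply, Matrix.smul_apply, Pi.smul_apply, one_smul, one_pow,
    neg_one_sq] at h1 h2
  rw [Matrix.sub_apply, Pi.sub_apply, Matrix.smul_apply, Pi.smul_apply, Matrix.add_apply,
    Pi.add_apply, h1, h2]
  have e : D₀.curvature i a b x + letters D₀ D₁ i 1 a b x + letters D₀ D₁ i 2 a b x +
      (D₀.curvature i a b x + (-1 : ℝ) • letters D₀ D₁ i 1 a b x + letters D₀ D₁ i 2 a b x) =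
        (2 : ℝ) • (D₀.curvature i a b x + letters D₀ D₁ i 2 a b x) := by
    rw [two_smul, neg_one_smul]
    abel
  rw [e, smul_smul, inv_mul_cancel₀ two_ne_zero, one_smul, add_sub_cancel_left]

/-- `tr(Ω_tᵐ)(x) = Σ_e t^{wt e} tr(word X m e)(x)` at the points of `U_i` (the expansion of `Ω_tᵐ`
into words, traced). [cite: Kobayashi1987, Ch. II §2 (2.7)] -/
theorem trace_npow_curvature_line_apply (D₀ D₁ : V.Connection) {i : ι} {x : M}
    (hi : x ∈ V.baseSet i) (t : ℝ) (m : ℕ) :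
    (MatrixForm.npow ((line D₀ D₁ t).curvature i) m).trace x =
      ∑ e : Fin m → Fin 3, (t ^ MatrixForm.wordWt e) • (MatrixForm.word (letters D₀ D₁ i) m e).trace x := by
  have h : (MatrixForm.npow ((line D₀ D₁ t).curvature i) m).trace x =
      (∑ e : Fin m → Fin 3, (t ^ MatrixForm.wordWt e) • MatrixForm.word (letters D₀ D₁ i) m e).trace x := by
    simp only [Matrix.trace, Matrix.diag_apply, Finset.sum_apply]
    exact Finset.sum_congr rfl fun a _ ↦ npow_curvature_line_eq_sum_apply D₀ D₁ hi t m a a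
  rw [h, MatrixForm.trace_sum, Finset.sum_apply]
  exact Finset.sum_congr rfl fun e _ ↦ by rw [MatrixForm.trace_smul, Pi.smul_apply]

variable [IsManifold 𝓘(ℝ, E) ∞ M]

/-- **The letters transform by `g_ij⁻¹ (·) g_ij`** at `x ∈ U_i ∩ U_j`: `X_c^{(j)}(x) = (g_ji X_c^{(i)} g_ij)(x)`
for `c = 0, 1, 2` — each letter is, at the points of the charts, a fixed real combination of
curvatures of connections (`X₀ = Ω₀`, `letters_one_apply`, `letters_two_apply`), and curvatures
transform this way, (I.1.17). [cite: Kobayashi1987, Ch. I §1 (1.17)] -/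
theorem letters_apply_eq_gauge (D₀ D₁ : V.Connection) {i j : ι} {x : M} (hi : x ∈ V.baseSet i)
    (hj : x ∈ V.baseSet j) (c : Fin 3) (a b : Fin r) :
    letters D₀ D₁ j c a b x =
      (MatrixForm.mulLeft (V.coordChange j i) ((letters D₀ D₁ i c).mulRight (V.coordChange i j)))
        a b x := by
  rcases c with ⟨_ | _ | _ | n, hc⟩
  · exact D₀.curvature_apply_eq_gauge hi hj a b
  · exact MatrixForm.gauge_apply_congr (letters_one_apply D₀ D₁ hj) (letters_one_apply D₀ D₁ hi)
      (MatrixForm.gauge_apply_smul _ (MatrixForm.gauge_apply_sub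
        ((line D₀ D₁ 1).curvature_apply_eq_gauge hi hj)
        ((line D₀ D₁ (-1)).curvature_apply_eq_gauge hi hj))) a b
  · exact MatrixForm.gauge_apply_congr (letters_two_apply D₀ D₁ hj) (letters_two_apply D₀ D₁ hi)
      (MatrixForm.gauge_apply_sub (MatrixForm.gauge_apply_smul _ (MatrixForm.gauge_apply_add
        ((line D₀ D₁ 1).curvature_apply_eq_gauge hi hj)
        ((line D₀ D₁ (-1)).curvature_apply_eq_gauge hi hj)))
        (D₀.curvature_apply_eq_gauge hi hj)) a b
  · exact absurd hc (by omega)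

/-- **The words transform by `g_ij⁻¹ (·) g_ij`** at `x ∈ U_i ∩ U_j` (induction on the length, as for
the powers of the curvature, `npow_curvature_apply_eq_gauge`). [cite: Kobayashi1987, Ch. I §1 (1.17)] -/
theorem word_letters_apply_eq_gauge (D₀ D₁ : V.Connection) {i j : ι} {x : M}
    (hi : x ∈ V.baseSet i) (hj : x ∈ V.baseSet j) :
    ∀ (m : ℕ) (e : Fin m → Fin 3) (a b : Fin r), MatrixForm.word (letters D₀ D₁ j) m e a b x =
      (MatrixForm.mulLeft (V.coordChange j i)
        ((MatrixForm.word (letters D₀ D₁ i) m e).mulRight (V.coordChange i j))) a b x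
  | 0, e, a, b => by
    simpa only [MatrixForm.word_zero, MatrixForm.npow_zero] using
      D₀.npow_curvature_apply_eq_gauge hi hj 0 a b
  | m + 1, e, a, b => by
    rw [MatrixForm.word_succ, MatrixForm.word_succ, MatrixForm.mulRight_castDeg,
      MatrixForm.mulLeft_castDeg, MatrixForm.castDeg_apply, MatrixForm.castDeg_apply]
    exact MForm.castDeg_apply_eq _ (MatrixForm.wedge_apply_eq_gauge (V.coordChange_mul_symm i j hi hj)
      (word_letters_apply_eq_gauge D₀ D₁ hi hj m (Fin.init e))
      (letters_apply_eq_gauge D₀ D₁ hi hj (e (Fin.last m))) a b)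

/-- **The `τ_e` are frame independent**: `τ_e^{(j)}(x) = τ_e^{(i)}(x)` at `x ∈ U_i ∩ U_j` (the word
and `α = ω₁ − ω₀` transform by `g_ij⁻¹ (·) g_ij`, (I.1.7), and the trace is invariant) — "`f(α, Ω_t,
…, Ω_t)` is independent of `s`", Kobayashi p. 34. [cite: Kobayashi1987, Ch. II §2 (2.9)] -/
theorem transgressionTerm_apply_eq (D₀ D₁ : V.Connection) {i j : ι} {x : M} (hi : x ∈ V.baseSet i)
    (hj : x ∈ V.baseSet j) (p : ℕ) (e : Fin p → Fin 3) :
    transgressionTerm D₀ D₁ j p e x = transgressionTerm D₀ D₁ i p e x :=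
  MatrixForm.trace_apply_eq_of_gauge (V.coordChange_mul_symm i j hi hj)
    (MatrixForm.wedge_apply_eq_gauge (V.coordChange_mul_symm i j hi hj)
      (word_letters_apply_eq_gauge D₀ D₁ hi hj p e) (sub_form_apply_eq_gauge D₀ D₁ ⟨hi, hj⟩))

/-- **The local transgression forms agree on overlaps**: `ψ_j(x) = ψ_i(x)` at `x ∈ U_i ∩ U_j`
("hence a globally defined `(2k−1)`-form", Kobayashi p. 34). [cite: Kobayashi1987, Ch. II §2 (2.9)] -/
theorem transgressionLocal_apply_eq (D₀ D₁ : V.Connection) {i j : ι} {x : M} (hi : x ∈ V.baseSet i)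
    (hj : x ∈ V.baseSet j) (p : ℕ) :
    transgressionLocal D₀ D₁ j p x = transgressionLocal D₀ D₁ i p x := by
  simp only [transgressionLocal, Finset.sum_apply, Pi.smul_apply,
    transgressionTerm_apply_eq D₀ D₁ hi hj]

/-! ### (2.10): `dψ_i = tr(Ω₁^{p+1}) − tr(Ω₀^{p+1})` on `U_i` -/

/-- The `τ_e` are smooth at the points of `U_i`. [cite: Kobayashi1987, Ch. II §2 (2.9)] -/
theorem smoothAt_transgressionTerm (D₀ D₁ : V.Connection) {i : ι} {x : M} (hi : x ∈ V.baseSet i)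
    (p : ℕ) (e : Fin p → Fin 3) : (transgressionTerm D₀ D₁ i p e).SmoothAt x :=
  smoothAt_trace_word_wedge D₀ D₁ hi p e

/-- The local transgression form `ψ_i` is smooth at the points of `U_i`. [cite: Kobayashi1987, Ch. II §2 (2.9)] -/
theorem smoothAt_transgressionLocal (D₀ D₁ : V.Connection) {i : ι} {x : M} (hi : x ∈ V.baseSet i)
    (p : ℕ) : (transgressionLocal D₀ D₁ i p).SmoothAt x :=
  MForm.smoothAt_sum _ fun e _ ↦ (smoothAt_transgressionTerm D₀ D₁ hi p e).smul _

/-- `dψ_i(x) = Σ_e ((p+1)/(wt e+1)) (dτ_e)(x)` at the points of `U_i` (`d` through the finite sum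
and the real scalars at a point of smoothness). [cite: Kobayashi1987, Ch. II §2 (2.10)] -/
theorem mextDeriv_transgressionLocal_eq_sum (D₀ D₁ : V.Connection) {i : ι} {x : M}
    (hi : x ∈ V.baseSet i) (p : ℕ) :
    mextDeriv (transgressionLocal D₀ D₁ i p) x = ∑ e : Fin p → Fin 3,
      (((p + 1 : ℕ) : ℝ) / ((MatrixForm.wordWt e + 1 : ℕ) : ℝ)) •
        mextDeriv (transgressionTerm D₀ D₁ i p e) x := by
  rw [transgressionLocal, mextDeriv_sum_apply_of_smoothAt _ fun e _ ↦
    (smoothAt_transgressionTerm D₀ D₁ hi p e).smul _]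
  exact Finset.sum_congr rfl fun e _ ↦ by rw [mextDeriv_smul, Pi.smul_apply]

/-- **Kobayashi (2.10) in the frame `s_i`: `dψ_i = tr(Ω₁^{p+1}) − tr(Ω₀^{p+1})` at the points of
`U_i`.** Both `F(t) = tr(Ω_t^{p+1})(x) = Σ_e t^{wt e} tr(word X (p+1) e)(x)` and
`Ψ(t) = Σ_e ((p+1)/(wt e+1)) t^{wt e+1} (dτ_e)(x)` are polynomial in `t`; `F' = Ψ'` is
`(d/dt) tr(Ω_t^{p+1}) = (p+1) tr((A + 2tB) ∧ Ω_tᵖ) = (p+1) d tr(Ω_tᵖ ∧ α)` ((2.8) and the key identity,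
coefficientwise: `sum_pow_smul_mextDeriv_trace_word_wedge_apply` and the counting identity
`MatrixForm.sum_wordWt_mul_pow_smul_eq`); hence `F − Ψ` is constant, and `Ψ(0) = 0`,
`Ψ(1) = dψ_i(x)`, `F(1) = tr(Ω₁^{p+1})(x)`, `F(0) = tr(Ω₀^{p+1})(x)`. [cite: Kobayashi1987, Ch. II §2 (2.10)] -/
theorem mextDeriv_transgressionLocal_apply (D₀ D₁ : V.Connection) {i : ι} {x : M}
    (hi : x ∈ V.baseSet i) (p : ℕ) :
    mextDeriv (transgressionLocal D₀ D₁ i p) x =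
      (MatrixForm.npow (D₁.curvature i) (p + 1)).trace x -
        (MatrixForm.npow (D₀.curvature i) (p + 1)).trace x := by
  -- `F' = Ψ'` coefficientwise (values of forms at `x`): the counting identity and the expanded key
  -- identity
  have hrot : ∀ e : Fin (p + 1) → Fin 3,
      (MatrixForm.word (letters D₀ D₁ i) (p + 1) (e ∘ finRotate (p + 1))).trace x =
        (MatrixForm.word (letters D₀ D₁ i) (p + 1) e).trace x := fun e ↦ by
    rw [MatrixForm.trace_word_comp_finRotate]
  have key : ∀ t : ℝ, ∑ e : Fin (p + 1) → Fin 3,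
      ((MatrixForm.wordWt e : ℝ) * t ^ (MatrixForm.wordWt e - 1)) •
        (MatrixForm.word (letters D₀ D₁ i) (p + 1) e).trace x =
      ((p + 1 : ℕ) : ℝ) • ∑ e : Fin p → Fin 3,
        (t ^ MatrixForm.wordWt e) • mextDeriv (transgressionTerm D₀ D₁ i p e) x := fun t ↦ by
    rw [MatrixForm.sum_wordWt_mul_pow_smul_eq
        (fun e ↦ (MatrixForm.word (letters D₀ D₁ i) (p + 1) e).trace x) hrot t,
      ← sum_pow_smul_mextDeriv_trace_word_wedge_apply D₀ D₁ hi t p]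
    rfl
  -- `dψ_i(x)`, `tr(Ω₁^{p+1})(x)`, `tr(Ω₀^{p+1})(x)` as values of the two polynomials at `t = 1, 0`
  have hd := mextDeriv_transgressionLocal_eq_sum D₀ D₁ hi p
  have hF1 := trace_npow_curvature_line_apply D₀ D₁ hi 1 (p + 1)
  have hF0 := trace_npow_curvature_line_apply D₀ D₁ hi 0 (p + 1)
  rw [curvature_line_one] at hF1
  rw [curvature_line_zero] at hF0
  -- test against a tuple of tangent vectors: scalar polynomial functions of `t`
  refine ContinuousAlternatingMap.ext fun v ↦ ?_
  have hfd : ∀ t : ℝ, HasDerivAt (fun t : ℝ ↦ ∑ e : Fin (p + 1) → Fin 3,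
      (t ^ MatrixForm.wordWt e) • (MatrixForm.word (letters D₀ D₁ i) (p + 1) e).trace x v)
      (∑ e : Fin (p + 1) → Fin 3, ((MatrixForm.wordWt e : ℝ) * t ^ (MatrixForm.wordWt e - 1)) •
        (MatrixForm.word (letters D₀ D₁ i) (p + 1) e).trace x v) t := fun t ↦
    HasDerivAt.fun_sum fun e _ ↦ (hasDerivAt_pow _ t).smul_const _
  have hψd : ∀ t : ℝ, HasDerivAt (fun t : ℝ ↦ ∑ e : Fin p → Fin 3,
      ((((p + 1 : ℕ) : ℝ) / ((MatrixForm.wordWt e + 1 : ℕ) : ℝ)) * t ^ (MatrixForm.wordWt e + 1)) •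
        mextDeriv (transgressionTerm D₀ D₁ i p e) x v)
      (∑ e : Fin p → Fin 3, ((((p + 1 : ℕ) : ℝ) / ((MatrixForm.wordWt e + 1 : ℕ) : ℝ)) *
        (((MatrixForm.wordWt e + 1 : ℕ) : ℝ) * t ^ (MatrixForm.wordWt e + 1 - 1))) •
          mextDeriv (transgressionTerm D₀ D₁ i p e) x v) t := fun t ↦
    HasDerivAt.fun_sum fun e _ ↦ ((hasDerivAt_pow _ t).const_mul _).smul_const _
  have hkey : ∀ t : ℝ, ∑ e : Fin (p + 1) → Fin 3,
      ((MatrixForm.wordWt e : ℝ) * t ^ (MatrixForm.wordWt e - 1)) •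
        (MatrixForm.word (letters D₀ D₁ i) (p + 1) e).trace x v =
      ∑ e : Fin p → Fin 3, ((((p + 1 : ℕ) : ℝ) / ((MatrixForm.wordWt e + 1 : ℕ) : ℝ)) *
        (((MatrixForm.wordWt e + 1 : ℕ) : ℝ) * t ^ (MatrixForm.wordWt e + 1 - 1))) •
          mextDeriv (transgressionTerm D₀ D₁ i p e) x v := fun t ↦ by
    have h := congrArg (fun A ↦ A v) (key t)
    simp only [ContinuousAlternatingMap.sum_apply, ContinuousAlternatingMap.smul_apply] at h
    rw [h, Finset.smul_sum]
    refine Finset.sum_congr rfl fun e _ ↦ ?_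
    have hne : ((MatrixForm.wordWt e + 1 : ℕ) : ℝ) ≠ 0 := Nat.cast_ne_zero.mpr (Nat.succ_ne_zero _)
    rw [smul_smul, Nat.add_sub_cancel, ← mul_assoc, div_mul_cancel₀ _ hne]
  -- hence the two scalar polynomials differ by a constant
  have hconst := is_const_of_deriv_eq_zero (fun t ↦ ((hfd t).sub (hψd t)).differentiableAt)
    (fun t ↦ by rw [((hfd t).sub (hψd t)).deriv, hkey t, sub_self]) 1 0
  simp only [Pi.sub_apply, one_pow, one_smul, mul_one, pow_succ, mul_zero, zero_smul,
    Finset.sum_const_zero, sub_zero] at hconst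
  -- evaluate
  have hdv := congrArg (fun A ↦ A v) hd
  have hF1v := congrArg (fun A ↦ A v) hF1
  have hF0v := congrArg (fun A ↦ A v) hF0
  simp only [ContinuousAlternatingMap.sum_apply, ContinuousAlternatingMap.smul_apply, one_pow,
    one_smul] at hdv hF1v hF0v
  change mextDeriv (transgressionLocal D₀ D₁ i p) x v =
    (MatrixForm.npow (D₁.curvature i) (p + 1)).trace x v -
      (MatrixForm.npow (D₀.curvature i) (p + 1)).trace x v
  rw [hdv, hF1v, hF0v, ← hconst, sub_sub_cancel]

/-! ### The global transgression form and the discharge -/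

/-- **The transgression form (Kobayashi (2.9)–(2.10)).** For two connections `D₀`, `D₁` and every
`p` there is a global smooth `(2p+1)`-form `φ` on `M` with `dφ = tr(Ω₁^{p+1}) − tr(Ω₀^{p+1})` in
every frame: glue the `ψ_i` (they agree on overlaps, `transgressionLocal_apply_eq`, and are smooth
with the right `d` at the points of their charts; `tr(Ω^{p+1})` is frame independent).
[cite: Kobayashi1987, Ch. II §2 (2.9)–(2.10)] -/
theorem exists_transgression (D₀ D₁ : V.Connection) (p : ℕ) :
    ∃ φ : MForm 𝓘(ℝ, E) M ℂ (2 * p + 1), IsSmoothForm φ ∧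
      ∀ i, ∀ x ∈ V.baseSet i, mextDeriv φ x =
        (MatrixForm.npow (D₁.curvature i) (p + 1)).trace x -
          (MatrixForm.npow (D₀.curvature i) (p + 1)).trace x := by
  choose idx hidx using V.exists_mem_baseSet
  have hloc : ∀ x, ∀ᶠ y in 𝓝 x,
      (fun y ↦ transgressionLocal D₀ D₁ (idx y) p y : MForm 𝓘(ℝ, E) M ℂ (2 * p + 1)) y =
        transgressionLocal D₀ D₁ (idx x) p y := fun x ↦ by
    filter_upwards [(V.isOpen_baseSet (idx x)).mem_nhds (hidx x)] with y hy
    exact transgressionLocal_apply_eq D₀ D₁ hy (hidx y) p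
  refine ⟨fun y ↦ transgressionLocal D₀ D₁ (idx y) p y, fun x ↦ ?_, fun i x hx ↦ ?_⟩
  · exact (smoothAt_transgressionLocal D₀ D₁ (hidx x) p).congr_of_eventuallyEq
      ((hloc x).mono fun y hy ↦ hy.symm)
  · rw [mextDeriv_congr_of_eventuallyEq (hloc x), mextDeriv_transgressionLocal_apply D₀ D₁ (hidx x) p,
      D₁.trace_npow_curvature_apply_eq hx (hidx x), D₀.trace_npow_curvature_apply_eq hx (hidx x)]

end Connection

section Discharge

variable (E : Type u) [NormedAddCommGroup E] [NormedSpace ℂ E] [FiniteDimensional ℂ E]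
  (M : Type v) [TopologicalSpace M] [ChartedSpace E M]

/-- **Discharge of the named fact `SmoothComplexVectorBundle.mk_eq_mk_of_isChernCharacterForm`
("Chern–Weil II", `ChernCharacter.lean`; Kobayashi, Ch. II §2 (2.5)–(2.10)):** the de Rham class of
a global Chern character form does not depend on the connection. For `k = 0` both forms are the
constant `r`; for `k = p + 1`, `θ₀ − θ₁ = d(−c_{p+1} φ)` on every `U_i` (hence everywhere) for the
transgression form `φ` of `Connection.exists_transgression`, `c_{p+1}` the normalising constant of
`ch_{p+1}`, so `θ₀ − θ₁` is exact. [cite: Kobayashi1987, Ch. II §2 (2.5)–(2.10)] -/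
theorem mk_eq_mk_of_isChernCharacterForm_holds : mk_eq_mk_of_isChernCharacterForm E M := by
  intro _ ι r V D₀ D₁ k θ₀ θ₁ hs₀ hc₀ hs₁ hc₁ h₀ h₁
  cases k with
  | zero =>
    have e : θ₀ = θ₁ := h₀.eq_of_zero.trans h₁.eq_of_zero.symm
    subst e
    rfl
  | succ p =>
    obtain ⟨φ, hφ, hdφ⟩ := Connection.exists_transgression D₀ D₁ p
    rw [Literature.NumberTheory.Transcendental.complexDeRhamCohomology.mk_eq_mk_iff]
    change θ₀ - θ₁ ∈ Submodule.span ℂ (mextDeriv ''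
      (Literature.NumberTheory.Transcendental.csmoothForms E M (2 * p + 1) :
        Set (MForm 𝓘(ℝ, E) M ℂ (2 * p + 1))))
    refine Submodule.subset_span
      ⟨(-(((p + 1).factorial : ℂ)⁻¹ * (-1 / (2 * Real.pi * Complex.I)) ^ (p + 1))) • φ, ?_, ?_⟩
    · exact (Literature.NumberTheory.Transcendental.mem_csmoothForms_iff _).mpr (hφ.smul_complex _)
    · rw [Literature.NumberTheory.Transcendental.mextDeriv_smul_complex_holds]
      funext x
      obtain ⟨i, hi⟩ := V.exists_mem_baseSet x
      rw [Pi.smul_apply, Pi.sub_apply, hdφ i x hi, h₀ i x hi, h₁ i x hi,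
        Connection.chernCharacterForm, Connection.chernCharacterForm, Pi.smul_apply, Pi.smul_apply,
        smul_sub, neg_smul, neg_smul, neg_sub_neg]

end Discharge

end SmoothComplexVectorBundle

end Literature.Geometry.Kaehler

end
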